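import Literature.Computability.Complexity.OrbitDecidersOracle
import Literature.Computability.Complexity.FPStepper
import HarnessLib

/-!
# `FP` steppers are orbit deciders; nesting an oracle orbit over an `FP` stepper

Glue between two toolkits of the tree's `PSPACE` programme:

* `FPStepper A` (`FPStepper.lean`): the decider of `A` as an iteration of polynomial-time string
  maps (`initFn`, `stepFn`, `haltFn`, `ansFn`) on codes of polynomial length that HALTS at some
  unspecified time — the interface through which `A ∈ PSPACE` is consumed in place ("each query is
  answered by running the space-bounded decider of `A` in the same space", Homer–Selman 2011,
  proof of Prop. 7.5 / Thm. 7.18; built for every `A ∈ PSPACE` from the universal step function in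
  the sequel announced there);
* `OrbitDecider A` (`OrbitDeciders.lean`): an `FP` round function read after EXACTLY `2^{|Nu y|}`
  rounds, and the relativized `OracleOrbitDecider B L` with its nesting theorem
  (`OrbitDecidersOracle.lean`).

Here an `FP` stepper is turned into an orbit decider (`FPStepper.toOrbitDecider`): the orbit state
is the code prefixed by its answer bit and its halt bit, the round freezes halted codes, and the
budget is `2^{2·bound(|y|) + 1}` rounds — enough because **a halting iteration on codes of length
`≤ b` halts within `(b + 1)·2^b` steps** (`FPStepper.haltTime_lt`: before the first halt the codes
are pairwise distinct, else the iteration would be periodic and never halt; pigeonhole into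
`Fin (b+1) × {0,1}^b` by length and zero-padding). Consequently
(`OracleOrbitDecider.nestStepper`, `OracleOrbitDecider.mem_PSPACE_of_stepper`) an oracle orbit
decider relative to a language with an `FP` stepper yields an orbit decider, and its language is in
`PSPACE` — the form in which the `PSPACE^{TQBF}` simulation of Aaronson–Chen's Lemma 5.3 consumes
`TQBF ∈ PSPACE`.

## References

* S. Arora, B. Barak, *Computational Complexity: A Modern Approach*, CUP 2009, Thm. 4.2 and §4.1
  (space-bounded computation; a space-`S` machine has at most `2^{O(S)}` configurations, so a
  halting run is that short — proof of Thm. 4.2/4.3), §3.4. [AroraBarakCC2009]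
* S. Homer, A. L. Selman, *Computability and Complexity Theory*, 2nd ed., Springer 2011, proof of
  Prop. 7.5 and Thm. 7.18. [HomerSelman2011]
* S. Hirahara, Z. Lu, H. Ren, *Bounded relativization*, CCC 2023, Rem. 2 (p. 3)
  (`PSPACE^PSPACE = PSPACE` with queries charged to space). [HiraharaLuRen2023]
-/

noncomputable section

namespace Literature.Computability.Complexity

open _root_.Computability Polynomial Brick

namespace FPStepper

variable {B : Language Bool} (S : FPStepper B)

/-! ### The first halting time and its bound -/

/-- The first halting time of the stepper on the query `y`. [folklore] -/
def haltTime (y : List Bool) : ℕ := Nat.find (S.halts y)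

/-- The stepper is halted at its halting time. [folklore] -/
theorem haltFn_haltTime (y : List Bool) : S.haltFn (S.stepFn^[S.haltTime y] (S.initFn y)) = [true] :=
  Nat.find_spec (S.halts y)

/-- Before the halting time the halt bit is `0`. [folklore] -/
theorem haltFn_of_lt {y : List Bool} {j : ℕ} (hj : j < S.haltTime y) : S.haltFn (S.stepFn^[j] (S.initFn y)) = [false] := by
  obtain ⟨b, hb⟩ := S.haltFn_bit y j
  have hmin : ¬ S.haltFn (S.stepFn^[j] (S.initFn y)) = [true] := Nat.find_min (S.halts y) hj
  cases b
  · exact hb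
  · exact absurd hb hmin

/-- **Codes before the first halt are pairwise distinct**: a repetition `i < i' ≤ haltTime` would
make the code at time `haltTime − (i' − i) < haltTime` equal to the halted one. [folklore] -/
theorem iterate_ne_of_lt_of_le {y : List Bool} {i i' : ℕ} (hi : i < i') (hi' : i' ≤ S.haltTime y) :
    S.stepFn^[i] (S.initFn y) ≠ S.stepFn^[i'] (S.initFn y) := by
  intro h
  set t := S.haltTime y - i' with ht
  have key : S.stepFn^[t + i] (S.initFn y) = S.stepFn^[S.haltTime y] (S.initFn y) := by
    rw [show S.haltTime y = t + i' by omega, Function.iterate_add_apply, Function.iterate_add_apply, h]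
  have hlt : t + i < S.haltTime y := by omega
  have h1 := S.haltFn_of_lt hlt
  rw [key, S.haltFn_haltTime] at h1
  exact absurd h1 (by simp)

/-- **A halting iteration on short codes halts soon**: `haltTime y < 2^{2·bound(|y|) + 1}` — the
codes before the first halt are distinct strings of length `≤ b = bound(|y|)`, of which there are
fewer than `(b + 1)·2^b` (length and zero-padding to `b` bits). The time bound of space-bounded
computation. [cite: AroraBarakCC2009, Thm. 4.2 and proof of Thm. 4.3 (a space-bounded machine has 2^{O(S)} configurations)] -/
theorem haltTime_lt (y : List Bool) : S.haltTime y < 2 ^ (2 * S.bound.eval y.length + 1) := by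
  set b := S.bound.eval y.length with hb
  by_contra hge
  push Not at hge
  let f : Fin (S.haltTime y + 1) → Fin (b + 1) × List.Vector Bool b := fun j =>
    (⟨(S.stepFn^[j] (S.initFn y)).length, Nat.lt_succ_of_le (S.length_le y j)⟩,
      ⟨S.stepFn^[j] (S.initFn y) ++ List.replicate (b - (S.stepFn^[j] (S.initFn y)).length) false, by
        have := S.length_le y j
        simp only [List.length_append, List.length_replicate]
        omega⟩)
  have hcard : Fintype.card (Fin (b + 1) × List.Vector Bool b) < Fintype.card (Fin (S.haltTime y + 1)) := by
    rw [Fintype.card_prod, Fintype.card_fin, Fintype.card_fin, card_vector, Fintype.card_bool]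
    -- `(b + 1) · 2^b ≤ 2^{2b+1}` (as in `SpaceTMSAT.succ_mul_two_pow_le`)
    have h2 : (b + 1) * 2 ^ b ≤ 2 ^ (2 * b + 1) := by
      rw [show 2 * b + 1 = (b + 1) + b by ring, pow_add]
      exact Nat.mul_le_mul_right _ (Nat.lt_two_pow_self).le
    omega
  obtain ⟨i, j, hne, hij⟩ := Fintype.exists_ne_map_eq_of_card_lt f hcard
  have hlen : (S.stepFn^[i] (S.initFn y)).length = (S.stepFn^[j] (S.initFn y)).length := by
    have := congrArg (fun p => (p.1 : ℕ)) hij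
    exact this
  have hcodes : S.stepFn^[i] (S.initFn y) = S.stepFn^[j] (S.initFn y) := by
    have := congrArg (fun p => p.2.toList) hij
    exact List.append_inj_left this hlen
  rcases Nat.lt_or_gt_of_ne (fun h : (i : ℕ) = j => hne (Fin.ext h)) with h | h
  · exact S.iterate_ne_of_lt_of_le h (Nat.le_of_lt_succ j.isLt) hcodes
  · exact S.iterate_ne_of_lt_of_le h (Nat.le_of_lt_succ i.isLt) hcodes.symm

/-! ### The orbit decider of a stepper -/

/-- The orbit state of a code: answer bit, halt bit, code. [folklore] -/
def wrap (c : List Bool) : List Bool := (S.ansFn c).headI :: (S.haltFn c).headI :: c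

/-- `wrap` as a string function. [folklore] -/
def wrapFn : List Bool → List Bool := fun c =>
  OrbitDecider.headBitFn S.ansFn c ++ (OrbitDecider.headBitFn S.haltFn c ++ c)

/-- `wrapFn = wrap`. [folklore] -/
@[simp] theorem wrapFn_apply (c : List Bool) : S.wrapFn c = S.wrap c := by
  simp [wrapFn, wrap, OrbitDecider.headBitFn_apply]

/-- `wrapFn ∈ FP`. [folklore] -/
theorem wrapFn_mem_FP : S.wrapFn ∈ FP :=
  append_mem_FP (OrbitDecider.headBitFn_mem_FP S.ansFn_mem)
    (append_mem_FP (OrbitDecider.headBitFn_mem_FP S.haltFn_mem) OracleCompose.id_mem_FP)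

/-- **The round**: a halted state (halt bit `1`) is frozen; otherwise step the code and re-wrap.
[cite: AroraBarakCC2009, §4.1] -/
def stepW : List Bool → List Bool :=
  iteFn (take1Fn ∘ List.tail) id (S.wrapFn ∘ S.stepFn ∘ List.tail ∘ List.tail)

/-- `stepW ∈ FP`. [folklore] -/
theorem stepW_mem_FP : S.stepW ∈ FP :=
  iteFn_mem_FP (comp_mem_FP take1Fn_mem_FP PRelSigma.tail_mem_FP) OracleCompose.id_mem_FP
    (comp_mem_FP S.wrapFn_mem_FP (comp_mem_FP S.stepFn_mem
      (comp_mem_FP PRelSigma.tail_mem_FP PRelSigma.tail_mem_FP)))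

/-- The initial state: the wrapped initial code. [folklore] -/
def initW : List Bool → List Bool := S.wrapFn ∘ S.initFn

/-- `initW ∈ FP`. [folklore] -/
theorem initW_mem_FP : S.initW ∈ FP := comp_mem_FP S.wrapFn_mem_FP S.initFn_mem

/-- The unary budget `1^{2·bound(|y|) + 1}`. [folklore] -/
def NuW : List Bool → List Bool := Plumb.polyFn (2 * S.bound + 1)

/-- `NuW ∈ FP`. [folklore] -/
theorem NuW_mem_FP : S.NuW ∈ FP := Plumb.polyFn_mem_FP _

/-- Length of the budget. [folklore] -/
@[simp] theorem length_NuW (y : List Bool) : (S.NuW y).length = 2 * S.bound.eval y.length + 1 := by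
  simp [NuW]

/-- The round on a wrapped code. [folklore] -/
theorem stepW_wrap (c : List Bool) :
    S.stepW (S.wrap c) = if (S.haltFn c).headI = true then S.wrap c else S.wrap (S.stepFn c) := by
  rw [stepW]
  have htest : (take1Fn ∘ List.tail) (S.wrap c) = [(S.haltFn c).headI] := rfl
  by_cases h : (S.haltFn c).headI = true
  · rw [iteFn_apply_true (by rw [htest, h]), if_pos h]; rfl
  · rw [iteFn_apply_false (by rw [htest, Bool.eq_false_iff.2 h]), if_neg h]
    simp [wrap]

/-- **The orbit of the stepper's orbit decider**: after `j` rounds the state is the wrapped code at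
time `min j haltTime` (the iteration is frozen at its first halt). [cite: AroraBarakCC2009, §4.1] -/
theorem iterate_stepW (y : List Bool) (j : ℕ) :
    S.stepW^[j] (S.initW y) = S.wrap (S.stepFn^[min j (S.haltTime y)] (S.initFn y)) := by
  induction j with
  | zero => simp [initW]
  | succ j ih =>
    rw [Function.iterate_succ_apply', ih, stepW_wrap]
    by_cases hj : j < S.haltTime y
    · rw [min_eq_left hj.le, S.haltFn_of_lt hj, if_neg (by decide), min_eq_left (Nat.succ_le_of_lt hj),
        Function.iterate_succ_apply']
    · push Not at hj
      rw [min_eq_right hj, S.haltFn_haltTime, min_eq_right (Nat.le_succ_of_le hj)]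
      rfl

/-- **An `FP` stepper is an orbit decider** (round `stepW`, initial state `initW`, budget
`1^{2·bound + 1}`, space `2·bound + 3`). [cite: AroraBarakCC2009, Thm. 4.2 and §4.1] [cite: HomerSelman2011, proof of Prop. 7.5] -/
def toOrbitDecider : OrbitDecider B where
  F := S.stepW
  F_mem := S.stepW_mem_FP
  ι := S.initW
  ι_mem := S.initW_mem_FP
  Nu := S.NuW
  Nu_mem := S.NuW_mem_FP
  s := 2 * S.bound + 3
  Nu_le y := by simp
  size_le y k := by
    rw [iterate_stepW, wrap, List.length_cons, List.length_cons]
    have := S.length_le y (min k (S.haltTime y))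
    simp only [eval_add, eval_mul, eval_ofNat]
    omega
  correct y := by
    rw [iterate_stepW, length_NuW, min_eq_right (S.haltTime_lt y).le, wrap, List.headI_cons,
      S.ansFn_eq y _ (S.haltFn_haltTime y), List.headI_cons]
    exact (Set.mem_iff_boolIndicator B y).symm

/-- Hence a language with an `FP` stepper is in `PSPACE` (through the loop machine of an orbit
decider). [cite: AroraBarakCC2009, Thm. 4.2 and §4.1] -/
theorem mem_PSPACE (S : FPStepper B) : B ∈ PSPACE := S.toOrbitDecider.mem_PSPACE

end FPStepper

namespace OracleOrbitDecider

variable {B L : Language Bool}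

/-- **Nesting over an `FP` stepper**: an oracle orbit decider for `L` relative to `B` and an `FP`
stepper for `B` give an orbit decider for `L`. [cite: HiraharaLuRen2023, Rem. 2 (p. 3)] [cite: HomerSelman2011, proof of Thm. 7.18] -/
def nestStepper (E : OracleOrbitDecider B L) (S : FPStepper B) : OrbitDecider L :=
  E.nest S.toOrbitDecider

/-- **`L ∈ PSPACE`** whenever `L` has an oracle orbit decider relative to a language with an `FP`
stepper (`PSPACE^PSPACE = PSPACE`, queries charged to space). [cite: HiraharaLuRen2023, Rem. 2 (p. 3)] [cite: AroraBarakCC2009, Thm. 4.2 and §4.1] -/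
theorem mem_PSPACE_of_stepper (E : OracleOrbitDecider B L) (S : FPStepper B) : L ∈ PSPACE :=
  (E.nestStepper S).mem_PSPACE

end OracleOrbitDecider

end Literature.Computability.Complexity

end
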